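import Summits.QuantumFields.BalabanUV.Beta.GAN24.ThreeLegDoubleFreeze
import Literature.MathematicalPhysics.QuantumFieldTheory.Balaban1983to89.T4GaugeActionRatePair

/-!
# `BalabanUV.Beta.GAN24.ThreeLegDoubleFreezeSummable` — binder row G-an2-4 ∕ (CONV-C), W-slot, the (α-0) parity re-cut, located crux (Q-L-k₀)
# (COUNT C-leaf01-g74-1, journal l.53136): **THE THREE-LEG CORE, part 3 of 3 — THE CARRIER-FACING COROLLARIES**: the two outer layers of
# `ThreeLegDoubleFreeze.abs_threeLeg_blockSum_le` are SUMMABLE (so a carrier may interchange its finite fibre sums with them), and an entry bound in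
# `EnvelopeBlockSum.tsum_env4_le`'s currency packages into `LocStencil₂ · K (κ₀/(6(d+1)))` (`Push4Irr` §C, once and for all).

NOT IN PRINT; OUR PROOF ([folklore] real analysis; 0 `def`, 0 cited facts, 0 `def … : Prop`, 0 sorry, 0 wall binders).  HONEST FRAMING (cell contract,
verbatim): «discharging `BetaPertH` makes Bałaban's UV stability UNCONDITIONAL — a real constructive-QFT result; it is NOT the continuum limit and NOT
the Clay problem.»  HONEST DEPENDENCY (verbatim): «continuum YM on T⁴ ⇐ BetaPertH ∧ nine spine estimates (0/9 proved); BetaPertH ⇐ (D1) ∧ (D4) ∧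
CAP+tail; G-an2-4 gates asym, D1 and NE2/3/4.»

* §6 `summable_slotLayer` (`v ↦ h₁ v·Σ'_{v′} h₂ v′·wb v v′` summable at every kernel site), `summable_kernelLayer` (`x ↦ ρ x·(slot layers at x)` summable) —
  under part 1's standing hypotheses;
* §7 (`l1_le_mul_supNorm` is `Literature…T4GaugeActionRatePair`'s — v1.1: the local copy bounced `dedup.landed`, p370247), **`locStencil₂_of_env_bound`** — `|Y κ u κ′ u′ x z a b| ≤ K·e^{−(κ₀/6)(‖u′−u‖∞+‖x−u‖∞+‖z−u‖∞)}` ⇒ `LocStencil₂ Y K (κ₀/(6(d+1)))`;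
  with `δ ≤ κ₀/(6(d+1))` this returns the table's own rate `δ`, as leaf-03's iterated socket (`LegTowerSlavedRows.good_window`) requires.
THIS IS NOT (H1♮) (carrier ∕ nesting, dressing, charges-from-divergences = `GAN24/SlotChargeMoment`, socket instantiation are other files); discharges NOTHING
of (Q-L) ∕ (C) ∕ «T2Shape» ∕ «T2Drift» ∕ (hW, hWall); NEVER «G-an2-4 closed» as (CONV-C); NOT D1, NOT `BetaPertH`, NOT continuum, NOT Clay; not in print.
Unit `b2b-balaban-gan24-formalise-leaf-01` (G-an2-4 formalisation swarm, leaf prover 01, gen 74), 2026-08-23.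
-/

noncomputable section

open Finset
open scoped BigOperators
open Literature.MathematicalPhysics.QuantumFieldTheory.LatticeForm (quo)
open Literature.MathematicalPhysics.QuantumFieldTheory.Balaban1983to89
open Literature.MathematicalPhysics.QuantumFieldTheory.Balaban1983to89.Beta
open B4ContourShift (supNorm abs_le_supNorm supNorm_nonneg)
open B12Sec2to5 (l1 l1_nonneg)
open T4GaugeActionRatePair (l1_le_mul_supNorm)
open ExpKernelCalculus (Zl Zl_nonneg Zl_pos)
open AffineAveraging (box toSite)
open BalabanCompositeJets (LocStencil₂)
open Summit.QuantumFields.BalabanUV.Beta.GAN24.BiStencilZeroMode (Tab)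
open Summit.QuantumFields.BalabanUV.Beta.GAN24.EnvelopeBlockSum (env_le_one tsum_env4_le)
open Summit.QuantumFields.BalabanUV.Beta.GAN24.ThreeLegFreezeBricks
open Summit.QuantumFields.BalabanUV.Beta.GAN24.ThreeLegDoubleFreeze

namespace Summit.QuantumFields.BalabanUV.Beta.GAN24.ThreeLegDoubleFreezeSummable

variable {d : ℕ}

/-! ## §6 Summability of the two outer layers -/

section Core

variable {L : ℕ} {κ₀ δ a a' aρ C g : ℝ} {h₁ h₂ ρ : (Fin (d + 1) → ℤ) → ℝ}
  {W : (Fin (d + 1) → ℤ) → (Fin (d + 1) → ℤ) → (Fin (d + 1) → ℤ) → (Fin (d + 1) → ℤ) → ℝ}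
  {c₁ c₂ c₃ c₄ : Fin (d + 1) → ℤ}
  (hL : 1 ≤ L) (hκ : 0 < κ₀) (hδ : 0 < δ) (hgap : κ₀ ≤ δ / 6 * L)
  (ha : 0 ≤ a) (ha' : 0 ≤ a') (haρ : 0 ≤ aρ) (hC : 0 ≤ C) (hg : 0 ≤ g)
  (hh₁ : ∀ v, |h₁ v| ≤ a * Real.exp (-(κ₀ * supNorm (quo L v - c₁))))
  (hh₁' : ∀ v i, |h₁ (v + Pi.single i 1) - h₁ v| ≤ a' * Real.exp (-(κ₀ * supNorm (quo L v - c₁))))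
  (hh₂ : ∀ v, |h₂ v| ≤ a * Real.exp (-(κ₀ * supNorm (quo L v - c₂))))
  (hh₂' : ∀ v i, |h₂ (v + Pi.single i 1) - h₂ v| ≤ a' * Real.exp (-(κ₀ * supNorm (quo L v - c₂))))
  (hρ : ∀ x, |ρ x| ≤ aρ * Real.exp (-(κ₀ * supNorm (quo L x - c₃))))
  (hW : ∀ v v' x p, |W v v' x p| ≤ C * Real.exp (-δ * l1 (v' - v)) * Real.exp (-δ * (l1 (x - v) + l1 (p - v))))
  (hq₂ : ∀ v x p, |∑' v', W v v' x p| ≤ g * Real.exp (-δ * (l1 (x - v) + l1 (p - v))))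
  (hq₁ : ∀ v' x p, |∑' v, W v v' x p| ≤ g * Real.exp (-δ * (l1 (x - v') + l1 (p - v'))))
  (hq₁₂ : ∀ x p, |∑' v, ∑' v', W v v' x p| ≤ g * Real.exp (-δ * l1 (p - x)))

/-! ### Summabilities and the Lipschitz transfers of the two slot legs -/

include hL hκ hδ hgap ha ha' hC hg hh₁ hh₂ hh₂' hW hq₂ in
/-- [folklore] The outer slot layer is summable (for the carrier's finite-sum interchanges): `v ↦ h₁ v·Σ'_{v′} h₂ v′·wb v v′` is dominated by
`a·(first-moment remainder + a·charge)·e^{−(δ/3)|v−x|₁}`. -/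
theorem summable_slotLayer (x : Fin (d + 1) → ℤ) :
    Summable fun v => h₁ v * ∑' v', h₂ v' * ∑ t ∈ box (d + 1) L, W v v' x ((L : ℤ) • c₄ + toSite t) := by
  have hδ3 : 0 < δ / 3 := by positivity
  have hsup₁ : ∀ v, |h₁ v| ≤ a := fun v => (hh₁ v).trans (by nlinarith [env_le_one (L := L) hκ.le c₁ v])
  -- `I v = ID v + h₂ x · Q₂ v`, both decaying at rate `δ/3` about `x`
  have hI : ∀ v, ∑' v', h₂ v' * ∑ t ∈ box (d + 1) L, W v v' x ((L : ℤ) • c₄ + toSite t)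
      = (∑' v', (h₂ v' - h₂ x) * ∑ t ∈ box (d + 1) L, W v v' x ((L : ℤ) • c₄ + toSite t))
        + h₂ x * ∑ t ∈ box (d + 1) L, ∑' v', W v v' x ((L : ℤ) • c₄ + toSite t) :=
    fun v => (inner_layer (c₄ := c₄) hL hκ hδ hgap ha ha' hC hh₂ hh₂' hW v x).2.2.1
  have hID : ∀ v, |∑' v', (h₂ v' - h₂ x) * ∑ t ∈ box (d + 1) L, W v v' x ((L : ℤ) • c₄ + toSite t)|
      ≤ ((a' * Real.exp κ₀ * Real.exp (-(κ₀ * supNorm (quo L x - c₂)))) *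
          (C * Real.exp κ₀ * Zl (d + 1) (δ / 6) * Real.exp (-(κ₀ * supNorm (quo L x - c₄)))) * (2 / (δ / 6) * Zl (d + 1) (δ / 6 / 2))) *
          Real.exp (-(δ / 3) * l1 (v - x)) := fun v => by
    have h := (inner_layer (c₄ := c₄) hL hκ hδ hgap ha ha' hC hh₂ hh₂' hW v x).2.2.2
    refine h.trans (le_of_eq ?_); ring
  have hQ₂ : ∀ v, |h₂ x * ∑ t ∈ box (d + 1) L, ∑' v', W v v' x ((L : ℤ) • c₄ + toSite t)|
      ≤ (a * (g * Real.exp κ₀ * Zl (d + 1) (δ / 6) * Real.exp (-(κ₀ * supNorm (quo L x - c₄))))) * Real.exp (-(δ / 3) * l1 (v - x)) := by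
    intro v
    rw [abs_mul]
    have h2 : |h₂ x| ≤ a := (hh₂ x).trans (by nlinarith [env_le_one (L := L) hκ.le c₂ x])
    calc |h₂ x| * |∑ t ∈ box (d + 1) L, ∑' v', W v v' x ((L : ℤ) • c₄ + toSite t)|
        ≤ a * ((g * Real.exp κ₀ * Zl (d + 1) (δ / 6) * Real.exp (-(κ₀ * supNorm (quo L x - c₄)))) * Real.exp (-(δ / 3) * l1 (v - x))) :=
          mul_le_mul h2 (abs_boxq₂_le (c₄ := c₄) hL hκ hδ hgap hg hq₂ v x) (abs_nonneg _) ha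
      _ = _ := by ring
  have hS1 := (abs_tsum_sup_mul_le (u := x) hδ3 ha hsup₁ hID).1
  have hS2 := (abs_tsum_sup_mul_le (u := x) hδ3 ha hsup₁ hQ₂).1
  have e : (fun v => h₁ v * ∑' v', h₂ v' * ∑ t ∈ box (d + 1) L, W v v' x ((L : ℤ) • c₄ + toSite t))
      = fun v => h₁ v * (∑' v', (h₂ v' - h₂ x) * ∑ t ∈ box (d + 1) L, W v v' x ((L : ℤ) • c₄ + toSite t))
          + h₁ v * (h₂ x * ∑ t ∈ box (d + 1) L, ∑' v', W v v' x ((L : ℤ) • c₄ + toSite t)) := by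
    funext v; rw [hI v]; ring
  rw [e]
  exact hS1.add hS2

include hL hκ hδ hgap ha ha' haρ hC hg hh₁ hh₁' hh₂ hh₂' hρ hW hq₂ hq₁ hq₁₂ in
/-- [folklore] The kernel layer is summable (for the carrier's finite-sum interchanges): `x ↦ ρ x·(slot layers at x)` is dominated by a multiple of the
four-envelope product `E_{c₁}E_{c₂}E_{c₃}E_{c₄}(x)` (`EnvelopeBlockSum.tsum_env4_le`). -/
theorem summable_kernelLayer :
    Summable fun x => ρ x * ∑' v, h₁ v * ∑' v', h₂ v' * ∑ t ∈ box (d + 1) L, W v v' x ((L : ℤ) • c₄ + toSite t) := by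
  have hZ := Zl_nonneg (D := d + 1) (show 0 < δ / 6 by positivity)
  have hZ' := Zl_nonneg (D := d + 1) (show 0 < δ / 6 / 2 by positivity)
  set Jc : ℝ := (Real.exp κ₀ * Zl (d + 1) (δ / 6)) *
      (a' ^ 2 * C * Real.exp κ₀ ^ 2 * (2 / (δ / 6) * Zl (d + 1) (δ / 6 / 2)) ^ 2
        + 2 * (a * a' * g * Real.exp κ₀ * (2 / (δ / 6) * Zl (d + 1) (δ / 6 / 2))) + a ^ 2 * g) with hJc
  have hE4 := tsum_env4_le (d := d) hL hκ c₁ c₂ c₃ c₄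
  refine Summable.of_norm_bounded (hE4.1.mul_left (aρ * Jc)) fun x => ?_
  rw [Real.norm_eq_abs, abs_mul]
  have hJ := abs_slotLayers_le (c₄ := c₄) hL hκ hδ hgap ha ha' hC hg hh₁ hh₁' hh₂ hh₂' hW hq₂ hq₁ hq₁₂ x
  rw [← hJc] at hJ
  calc |ρ x| * |∑' v, h₁ v * ∑' v', h₂ v' * ∑ t ∈ box (d + 1) L, W v v' x ((L : ℤ) • c₄ + toSite t)|
      ≤ (aρ * Real.exp (-(κ₀ * supNorm (quo L x - c₃)))) * (Jc * (Real.exp (-(κ₀ * supNorm (quo L x - c₁))) *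
          Real.exp (-(κ₀ * supNorm (quo L x - c₂))) * Real.exp (-(κ₀ * supNorm (quo L x - c₄))))) :=
        mul_le_mul (hρ x) hJ (abs_nonneg _) (by positivity)
    _ = _ := by ring

end Core

/-! ## §7 Packaging: from the envelope currency to `LocStencil₂` (`Push4Irr` §C, once and for all) -/

/-- [folklore] **PACKAGING**: a bi-table whose entries are bounded in `EnvelopeBlockSum.tsum_env4_le`'s currency about their first slot —
`|Y κ u κ′ u′ x z a b| ≤ K·e^{−(κ₀/6)(‖u′−u‖∞ + ‖x−u‖∞ + ‖z−u‖∞)}` — is `LocStencil₂ Y K (κ₀/(6(d+1)))` (sup-norm to `ℓ¹`, `Push4Irr` §C).  With the core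
`abs_threeLeg_blockSum_le` (after the carrier's fibre sums) this is the `LocStencil₂` form of the three-leg push at rate `κ₀/(6(d+1))`, hence at any
`δ ≤ κ₀/(6(d+1))` — the table's own rate, as the iterated socket requires. -/
theorem locStencil₂_of_env_bound {Y : Tab d} {K κ₀ : ℝ} (hK : 0 ≤ K) (hκ : 0 ≤ κ₀)
    (hY : ∀ κ u κ' u' x z a b, |Y κ u κ' u' x z a b| ≤ K * Real.exp (-(κ₀ / 6) * (supNorm (u' - u) + supNorm (x - u) + supNorm (z - u)))) :
    LocStencil₂ Y K (κ₀ / (6 * ((d : ℝ) + 1))) := by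
  intro κ u κ' u' x z a b
  refine (hY κ u κ' u' x z a b).trans ?_
  rw [mul_assoc]
  refine mul_le_mul_of_nonneg_left ?_ hK
  rw [← Real.exp_add, Real.exp_le_exp]
  have h123 : l1 (u' - u) + l1 (x - u) + l1 (z - u) ≤ ((d : ℝ) + 1) * (supNorm (u' - u) + supNorm (x - u) + supNorm (z - u)) := by
    have := add_le_add (add_le_add (l1_le_mul_supNorm (u' - u)) (l1_le_mul_supNorm (x - u))) (l1_le_mul_supNorm (z - u))
    linarith
  have hk : 0 ≤ κ₀ / (6 * ((d : ℝ) + 1)) := by positivity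
  have key := mul_le_mul_of_nonneg_left h123 hk
  have e : κ₀ / (6 * ((d : ℝ) + 1)) * (((d : ℝ) + 1) * (supNorm (u' - u) + supNorm (x - u) + supNorm (z - u)))
      = κ₀ / 6 * (supNorm (u' - u) + supNorm (x - u) + supNorm (z - u)) := by
    field_simp
  rw [e] at key
  linarith

end Summit.QuantumFields.BalabanUV.Beta.GAN24.ThreeLegDoubleFreezeSummable

end
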